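import Literature.MathematicalPhysics.QuantumLattice.HubbardOpenBoxSectorCodes
import Literature.MathematicalPhysics.QuantumLattice.HubbardOpenBoxMixedSectorWitness
import Literature.MathematicalPhysics.QuantumLattice.HubbardModelThermodynamicLimitProofs
import HarnessLib

/-!
# Kernel-checked exact-diagonalisation certificates: sector ground-energy FLOORS of the open
# `a × b` `t–t'` Hubbard cluster from a rounded `L D Lᵀ` factorisation

Topic `MathematicalPhysics/QuantumLattice`, family `hubbard`. The abstract duality
`B − c·1 ⪰ 0 ⇒ c ≤ E₀` for sector blocks is in the tree (`BootstrapCertificateDuality`,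
`le_groundEnergy_of_sectorBlock_posSemidef`; the finite-precision shift of a numerically obtained
certificate is Kull–Schuch–Dive–Navascués 2024 §5.3). This file makes it EXECUTABLE BY THE KERNEL for
the open-cluster Hamiltonian `hubbardOpenBoxTT' a b (TN/Q) (TD/Q) (UU/Q)` (rational couplings): with the
occupation-code dictionary (`HubbardOpenBoxCodedHamiltonian.hubbardOpenBoxTT'_apply_eq_code`) the block
of the spin sector `(N↑, N↓) = (p, q)` is the integer matrix
`hz i j = S·(−TN·hopNN − TD·hopDiag + UU·docc)(L_i, L_j)` over the positions of the sector's code list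
`L = sectorList a b p q` (`HubbardOpenBoxSectorCodes`), divided by `S·Q`.

* §1 the linear algebra of a ROUNDED certificate (pure `Fin n` sums): for integer data `Λ, Δ ≥ 0`,
  shift `c`, scale `K`, residual `E = K(hz − c·1) − Λ Δ Λᵀ`, if every absolute row and column sum of
  `E` is `≤ ρ` then `(Kc − ρ)‖w‖² ≤ K · re⟨w, hz w⟩` for all complex `w` (`cert_ineq`; the Gram part
  `Λ Δ Λᵀ` is positive, `re_gram_nonneg`, and `E` is controlled by the Gershgorin-type bound
  `re_quad_ge_neg_of_rows`).
* §2 the certificate format `SectorCert` (packed naturals `lam`, `del` of field width `w`, `S, K, c, ρ`),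
  the Boolean `SectorCert.check a b p q TN TD UU Q` (structural loops only — `decide +kernel`
  evaluates it), the floor `SectorCert.floor Q = (Kc − ρ)/(K S Q)`, and **`SectorCert.sound`**:
  `check = true ⇒ floor · ‖v‖² ≤ re⟨v, H v⟩` for every `v` supported in the spin sector `(p, q)`.
* §3 assembly: spin-sector floors for all `(p, k − p)` ⇒ `σ ≤ groundEnergy H k` (`k ≤ 2ab`;
  `le_groundEnergy_of_spinSectorFloors`, using `preservesSectors_hubbardOpenBoxTT'`), and the
  certificate form **`groundEnergy_ge_of_sectorCerts`** consumed by certificate files; its output is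
  exactly the hypothesis `σ k ≤ E₀(h_{a×b}, k)` of the Anderson cluster bounds
  (`ClusterLowerBound.energyDensityTT'_ge_of_boxFloors_2x3`).

Everything is proved; no named fact; nothing numerical is asserted here.

## References

* I. Kull, N. Schuch, B. Dive, M. Navascués, PRX 14 (2024) 021008, §5.3 (finite-precision shift of a
  numerical dual certificate). [cite: KullEtAl2024, §5.3]
* H. Q. Lin, J. E. Gubernatis, Comput. Phys. 7 (1993) 400, §II. [cite: LinGubernatis1993, §II]
* S. M. Rump, *Verification of positive definiteness*, BIT 46 (2006) 433, §2 (rounded Cholesky factor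
  plus a norm bound on the residual certifies definiteness). [cite: Rump2006PosDef, §2]
-/

namespace Literature.MathematicalPhysics.QuantumLattice

namespace OccupationCode

open Finset Matrix

/-! ### §1 The linear algebra of a rounded `L D Lᵀ` certificate -/

section Core

variable {n : ℕ}

/-- The residual of a rounded certificate: `E i j = K·(hz i j − c δ_ij) − Σ_k Λ_ik Δ_k Λ_jk`.
[cite: Rump2006PosDef, §2] -/
def residual (hz lam : Fin n → Fin n → ℤ) (del : Fin n → ℕ) (K c : ℤ) (i j : Fin n) : ℤ :=
  K * (hz i j - if i = j then c else 0) - ∑ k, lam i k * del k * lam j k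

/-- The Gram part is nonnegative: `re Σ_{ij} conj(w_i) (Σ_k Λ_ik Δ_k Λ_jk) w_j = Σ_k Δ_k |Σ_j Λ_jk w_j|² ≥ 0`.
[cite: Rump2006PosDef, §2] -/
theorem re_gram_nonneg (lam : Fin n → Fin n → ℤ) (del : Fin n → ℕ) (w : Fin n → ℂ) :
    0 ≤ (∑ i, ∑ j, (starRingEnd ℂ) (w i) * ((∑ k, lam i k * del k * lam j k : ℤ) : ℂ) * w j).re := by
  have key : (∑ i, ∑ j, (starRingEnd ℂ) (w i) * ((∑ k, lam i k * del k * lam j k : ℤ) : ℂ) * w j) =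
      ∑ k, ((del k : ℕ) : ℂ) * ((starRingEnd ℂ) (∑ i, (lam i k : ℂ) * w i) * (∑ j, (lam j k : ℂ) * w j)) := by
    -- both sides equal `Σ_k Σ_i Σ_j del_k Λ_ik conj(w_i) Λ_jk w_j`
    have lhs : (∑ i, ∑ j, (starRingEnd ℂ) (w i) * ((∑ k, lam i k * del k * lam j k : ℤ) : ℂ) * w j) =
        ∑ i, ∑ j, ∑ k, (del k : ℂ) * ((lam i k : ℂ) * (starRingEnd ℂ) (w i)) * ((lam j k : ℂ) * w j) := by
      refine Finset.sum_congr rfl fun i _ => Finset.sum_congr rfl fun j _ => ?_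
      rw [Int.cast_sum, Finset.mul_sum, Finset.sum_mul]
      refine Finset.sum_congr rfl fun k _ => ?_
      push_cast
      ring
    have rhs : (∑ k, ((del k : ℕ) : ℂ) * ((starRingEnd ℂ) (∑ i, (lam i k : ℂ) * w i) * (∑ j, (lam j k : ℂ) * w j))) =
        ∑ k, ∑ i, ∑ j, (del k : ℂ) * ((lam i k : ℂ) * (starRingEnd ℂ) (w i)) * ((lam j k : ℂ) * w j) := by
      refine Finset.sum_congr rfl fun k _ => ?_
      rw [map_sum, Finset.sum_mul, Finset.mul_sum]
      refine Finset.sum_congr rfl fun i _ => ?_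
      rw [Finset.mul_sum, Finset.mul_sum]
      refine Finset.sum_congr rfl fun j _ => ?_
      rw [map_mul, map_intCast]
      ring
    rw [lhs, rhs]
    calc (∑ i, ∑ j, ∑ k, (del k : ℂ) * ((lam i k : ℂ) * (starRingEnd ℂ) (w i)) * ((lam j k : ℂ) * w j))
        = ∑ i, ∑ k, ∑ j, (del k : ℂ) * ((lam i k : ℂ) * (starRingEnd ℂ) (w i)) * ((lam j k : ℂ) * w j) :=
          Finset.sum_congr rfl fun i _ => Finset.sum_comm
      _ = ∑ k, ∑ i, ∑ j, (del k : ℂ) * ((lam i k : ℂ) * (starRingEnd ℂ) (w i)) * ((lam j k : ℂ) * w j) :=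
          Finset.sum_comm
  rw [key, Complex.re_sum]
  refine Finset.sum_nonneg fun k _ => ?_
  rw [Complex.mul_re]
  have h2 : 0 ≤ ((starRingEnd ℂ) (∑ j, (lam j k : ℂ) * w j) * ∑ j, (lam j k : ℂ) * w j).re := by
    rw [mul_comm, Complex.mul_conj]; simp [Complex.normSq_nonneg]
  simp only [Complex.natCast_re, Complex.natCast_im, zero_mul, sub_zero]
  exact mul_nonneg (Nat.cast_nonneg _) h2

/-- Gershgorin-type bound: if all absolute row and column sums of an integer matrix `E` are `≤ ρ`, then
`re ⟨w, E w⟩ ≥ -ρ ‖w‖²`. [cite: Rump2006PosDef, §2] -/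
theorem re_quad_ge_neg_of_rows (E : Fin n → Fin n → ℤ) (ρ : ℕ)
    (hrow : ∀ i, ∑ j, |E i j| ≤ ρ) (hcol : ∀ j, ∑ i, |E i j| ≤ ρ) (w : Fin n → ℂ) :
    -((ρ : ℝ) * ∑ i, ‖w i‖ ^ 2) ≤ (∑ i, ∑ j, (starRingEnd ℂ) (w i) * (E i j : ℂ) * w j).re := by
  rw [Complex.re_sum]
  simp_rw [Complex.re_sum]
  -- each term: 2 re ≥ -|E i j| (|w i|^2 + |w j|^2)
  have hterm : ∀ i j, -(|(E i j : ℝ)| * (‖w i‖ ^ 2 + ‖w j‖ ^ 2)) ≤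
      2 * ((starRingEnd ℂ) (w i) * (E i j : ℂ) * w j).re := by
    intro i j
    have hle : |((starRingEnd ℂ) (w i) * (E i j : ℂ) * w j).re| ≤ |(E i j : ℝ)| * (‖w i‖ * ‖w j‖) := by
      refine (Complex.abs_re_le_norm _).trans ?_
      rw [norm_mul, norm_mul, Complex.norm_conj, Complex.norm_intCast, mul_comm (‖w i‖), mul_assoc]
    have hamgm : 2 * (‖w i‖ * ‖w j‖) ≤ ‖w i‖ ^ 2 + ‖w j‖ ^ 2 := by
      nlinarith [sq_nonneg (‖w i‖ - ‖w j‖), norm_nonneg (w i), norm_nonneg (w j)]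
    have := mul_le_mul_of_nonneg_left hamgm (abs_nonneg (E i j : ℝ))
    have h' := neg_abs_le (((starRingEnd ℂ) (w i) * (E i j : ℂ) * w j).re)
    nlinarith [abs_nonneg (E i j : ℝ)]
  have hsum : -(∑ i, ∑ j, |(E i j : ℝ)| * (‖w i‖ ^ 2 + ‖w j‖ ^ 2)) ≤
      2 * ∑ i, ∑ j, ((starRingEnd ℂ) (w i) * (E i j : ℂ) * w j).re := by
    rw [Finset.mul_sum, ← Finset.sum_neg_distrib]
    refine Finset.sum_le_sum fun i _ => ?_
    rw [Finset.mul_sum, ← Finset.sum_neg_distrib]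
    exact Finset.sum_le_sum fun j _ => hterm i j
  -- Σ_ij |E ij| (a_i + a_j) = Σ_i a_i rowsum_i + Σ_j a_j colsum_j ≤ 2 ρ Σ a
  have hsplit : ∑ i, ∑ j, |(E i j : ℝ)| * (‖w i‖ ^ 2 + ‖w j‖ ^ 2) =
      (∑ i, ‖w i‖ ^ 2 * ∑ j, |(E i j : ℝ)|) + (∑ j, ‖w j‖ ^ 2 * ∑ i, |(E i j : ℝ)|) := by
    have : ∀ i, ∑ j, |(E i j : ℝ)| * (‖w i‖ ^ 2 + ‖w j‖ ^ 2) =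
        ‖w i‖ ^ 2 * (∑ j, |(E i j : ℝ)|) + ∑ j, ‖w j‖ ^ 2 * |(E i j : ℝ)| := by
      intro i
      rw [Finset.mul_sum, ← Finset.sum_add_distrib]
      refine Finset.sum_congr rfl fun j _ => ?_
      ring
    simp_rw [this]
    rw [Finset.sum_add_distrib]
    congr 1
    rw [Finset.sum_comm]
    refine Finset.sum_congr rfl fun j _ => ?_
    rw [Finset.mul_sum]
  have hr : ∀ i, ∑ j, |(E i j : ℝ)| ≤ ρ := fun i => by exact_mod_cast hrow i
  have hc : ∀ j, ∑ i, |(E i j : ℝ)| ≤ ρ := fun j => by exact_mod_cast hcol j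
  have e1 : ∑ i, ‖w i‖ ^ 2 * ∑ j, |(E i j : ℝ)| ≤ ∑ i, ‖w i‖ ^ 2 * ρ :=
    Finset.sum_le_sum fun i _ => mul_le_mul_of_nonneg_left (hr i) (sq_nonneg _)
  have e2 : ∑ j, ‖w j‖ ^ 2 * ∑ i, |(E i j : ℝ)| ≤ ∑ j, ‖w j‖ ^ 2 * ρ :=
    Finset.sum_le_sum fun j _ => mul_le_mul_of_nonneg_left (hc j) (sq_nonneg _)
  rw [← Finset.sum_mul] at e1 e2
  rw [hsplit] at hsum
  linarith

/-- **The certificate inequality.** If the residual `E = K(hz − c·1) − Λ Δ Λᵀ` has absolute row and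
column sums `≤ ρ`, then `(K c − ρ) ‖w‖² ≤ K · re ⟨w, hz w⟩` for every complex vector `w`.
[cite: KullEtAl2024, §5.3] [cite: Rump2006PosDef, §2] -/
theorem cert_ineq (hz lam : Fin n → Fin n → ℤ) (del : Fin n → ℕ) (K c : ℤ) (ρ : ℕ)
    (hrow : ∀ i, ∑ j, |residual hz lam del K c i j| ≤ ρ)
    (hcol : ∀ j, ∑ i, |residual hz lam del K c i j| ≤ ρ) (w : Fin n → ℂ) :
    ((K * c : ℤ) - ρ : ℝ) * ∑ i, ‖w i‖ ^ 2 ≤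
      (K : ℝ) * (∑ i, ∑ j, (starRingEnd ℂ) (w i) * (hz i j : ℂ) * w j).re := by
  have hE := re_quad_ge_neg_of_rows (residual hz lam del K c) ρ hrow hcol w
  have hG := re_gram_nonneg lam del w
  -- pointwise decomposition `K hz_ij = E_ij + K c δ_ij + G_ij`
  have hpt : ∀ i j, (K : ℂ) * ((starRingEnd ℂ) (w i) * (hz i j : ℂ) * w j) =
      (starRingEnd ℂ) (w i) * (residual hz lam del K c i j : ℂ) * w j +
        (starRingEnd ℂ) (w i) * ((K : ℂ) * (if i = j then (c : ℂ) else 0)) * w j +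
          (starRingEnd ℂ) (w i) * ((∑ k, lam i k * del k * lam j k : ℤ) : ℂ) * w j := by
    intro i j
    simp only [residual, Int.cast_sub, Int.cast_mul, Int.cast_ite, Int.cast_zero]
    ring
  have hdec : (K : ℂ) * (∑ i, ∑ j, (starRingEnd ℂ) (w i) * (hz i j : ℂ) * w j) =
      (∑ i, ∑ j, (starRingEnd ℂ) (w i) * (residual hz lam del K c i j : ℂ) * w j) +
        (∑ i, ∑ j, (starRingEnd ℂ) (w i) * ((K : ℂ) * (if i = j then (c : ℂ) else 0)) * w j) +
          ∑ i, ∑ j, (starRingEnd ℂ) (w i) * ((∑ k, lam i k * del k * lam j k : ℤ) : ℂ) * w j := by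
    rw [Finset.mul_sum, ← Finset.sum_add_distrib, ← Finset.sum_add_distrib]
    refine Finset.sum_congr rfl fun i _ => ?_
    rw [Finset.mul_sum, ← Finset.sum_add_distrib, ← Finset.sum_add_distrib]
    exact Finset.sum_congr rfl fun j _ => hpt i j
  have hdiag : (∑ i, ∑ j, (starRingEnd ℂ) (w i) * ((K : ℂ) * (if i = j then (c : ℂ) else 0)) * w j) =
      (((K * c : ℤ) : ℝ) : ℂ) * ((∑ i, ‖w i‖ ^ 2 : ℝ) : ℂ) := by
    have : ∀ i, (∑ j, (starRingEnd ℂ) (w i) * ((K : ℂ) * (if i = j then (c : ℂ) else 0)) * w j) =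
        (K : ℂ) * (c : ℂ) * ((‖w i‖ ^ 2 : ℝ) : ℂ) := by
      intro i
      rw [Finset.sum_eq_single i (fun j _ hj => by simp [Ne.symm hj]) (by simp)]
      rw [if_pos rfl, show ((‖w i‖ ^ 2 : ℝ) : ℂ) = (starRingEnd ℂ) (w i) * w i from by
        rw [mul_comm, Complex.mul_conj, Complex.normSq_eq_norm_sq]]
      ring
    simp_rw [this]
    rw [← Finset.mul_sum]
    push_cast
    ring
  have hK : (K : ℂ) = ((K : ℝ) : ℂ) := (Complex.ofReal_intCast K).symm
  have lhs_re : ((K : ℂ) * (∑ i, ∑ j, (starRingEnd ℂ) (w i) * (hz i j : ℂ) * w j)).re =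
      (K : ℝ) * (∑ i, ∑ j, (starRingEnd ℂ) (w i) * (hz i j : ℂ) * w j).re := by
    rw [hK, Complex.re_ofReal_mul]
  have hdiag_re : (∑ i, ∑ j, (starRingEnd ℂ) (w i) * ((K : ℂ) * (if i = j then (c : ℂ) else 0)) * w j).re =
      ((K * c : ℤ) : ℝ) * ∑ i, ‖w i‖ ^ 2 := by
    rw [hdiag, ← Complex.ofReal_mul, Complex.ofReal_re]
  rw [← lhs_re, hdec, Complex.add_re, Complex.add_re, hdiag_re]
  have hcast : (((K * c : ℤ) - ρ : ℝ)) = ((K * c : ℤ) : ℝ) - (ρ : ℝ) := by push_cast; ring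
  linarith [hE, hG]

end Core

/-! ### §2 The certificate format, the kernel checker and its soundness -/

/-- `∀ i < n, f i` by structural recursion (kernel-friendly). [folklore] -/
def allNat (f : ℕ → Bool) : ℕ → Bool
  | 0 => true
  | n + 1 => allNat f n && f n

/-- `allNat f n = true` gives `f i = true` for every `i < n`. [cite: Neumaier2004CompleteSearch, §11] -/
theorem of_allNat {f : ℕ → Bool} : ∀ {n : ℕ}, allNat f n = true → ∀ i < n, f i = true
  | 0, _, i, hi => absurd hi (Nat.not_lt_zero i)
  | n + 1, h, i, hi => by
    rw [allNat, Bool.and_eq_true] at h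
    rcases Nat.lt_succ_iff_lt_or_eq.1 hi with hi | rfl
    exacts [of_allNat h.1 i hi, h.2]

/-- Field number `idx` (width `w` bits) of the packed natural `T`. [cite: LinGubernatis1993, §II] -/
def field (T w idx : ℕ) : ℕ := T / 2 ^ (w * idx) % 2 ^ w

/-- **An exact-diagonalisation floor certificate for one spin sector** of an open cluster: the integer
scale `S` of the block, the residual scale `K`, the shift `c`, and the rounded factor `Λ` (packed in
`lam`, `n × n` row-major fields of width `w`, offset `2^(w-1)`) and diagonal `Δ ≥ 0` (packed in `del`)
of `K(S·Q·H|_{(p,q)} − c) ≈ Λ Δ Λᵀ`, with the claimed bound `ρ` on the residual's absolute row/column sums.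
[cite: Rump2006PosDef, §2] -/
structure SectorCert where
  /-- scale of the integer block -/
  S : ℕ
  /-- scale of the residual -/
  K : ℕ
  /-- shift -/
  c : ℤ
  /-- field width of the packed tables -/
  w : ℕ
  /-- packed `Λ` -/
  lam : ℕ
  /-- packed `Δ` -/
  del : ℕ
  /-- bound on the absolute row and column sums of the residual -/
  ρ : ℕ

namespace SectorCert

variable (C : SectorCert)

/-- The scaled integer block entry between the codes `m, m'`:
`S·(−TN·hopNN − TD·hopDiag + UU·docc)(m, m')`, i.e. `S·Q` times the entry of
`H^open(TN/Q, TD/Q, UU/Q)` between the decoded configurations. [cite: LinGubernatis1993, §II] -/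
def hzCode (a b : ℕ) (TN TD UU : ℤ) (m m' : ℕ) : ℤ :=
  C.S * (-TN * openBoxHopNN a b m m' - TD * openBoxHopDiag a b m m' + UU * doccCode a b m m')

/-- The factor entry `Λ_ik` (positions `i, k < n`). [cite: Rump2006PosDef, §2] -/
def lamAt (n i k : ℕ) : ℤ := (field C.lam C.w (i * n + k) : ℤ) - 2 ^ (C.w - 1)

/-- The diagonal entry `Δ_k ≥ 0`. [cite: Rump2006PosDef, §2] -/
def delAt (k : ℕ) : ℕ := field C.del C.w k

/-- The residual entry `E_ij = K(hz_ij − c δ_ij) − Σ_k Λ_ik Δ_k Λ_jk` between the positions `i, j` of the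
code list `L` (length `n`). [cite: Rump2006PosDef, §2] -/
def resid (a b : ℕ) (TN TD UU : ℤ) (L : ℕ → ℕ) (n i j : ℕ) : ℤ :=
  C.K * (C.hzCode a b TN TD UU (L i) (L j) - if i = j then C.c else 0) -
    sumNat (fun k => C.lamAt n i k * C.delAt k * C.lamAt n j k) n

/-- **THE KERNEL CHECKER** for the spin sector `(N↑, N↓) = (p, q)` of the open `a × b` cluster with
couplings `(TN/Q, TD/Q, UU/Q)`: `Q, S, K > 0` and every absolute row and column sum of the residual over
the sector's code list is `≤ ρ`. Structural loops only (`decide +kernel`). [cite: Rump2006PosDef, §2] -/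
def check (a b p q : ℕ) (TN TD UU : ℤ) (Q : ℕ) : Bool :=
  decide (0 < Q) && decide (0 < C.S) && decide (0 < C.K) &&
    allNat (fun i => decide (sumNat (fun j => |C.resid a b TN TD UU (fun i => (sectorList a b p q).getD i 0)
      (sectorList a b p q).length i j|) (sectorList a b p q).length ≤ (C.ρ : ℤ))) (sectorList a b p q).length &&
    allNat (fun j => decide (sumNat (fun i => |C.resid a b TN TD UU (fun i => (sectorList a b p q).getD i 0)
      (sectorList a b p q).length i j|) (sectorList a b p q).length ≤ (C.ρ : ℤ))) (sectorList a b p q).length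

/-- **The certified floor** `(K c − ρ)/(K S Q)`. [cite: KullEtAl2024, §5.3] -/
def floor (Q : ℕ) : ℚ := (((C.K : ℤ) * C.c - C.ρ : ℤ) : ℚ) / ((C.K : ℚ) * C.S * Q)

section Sound

variable {a b p q : ℕ} {TN TD UU : ℤ} {Q : ℕ}

/-- A structural sum over `range n` of an integer function is the `Fin n` sum. [folklore] -/
private theorem sumNat_eq_sum_fin {α : Type*} [AddCommMonoid α] (f : ℕ → α) (n : ℕ) :
    sumNat f n = ∑ i : Fin n, f i := by
  rw [sumNat_eq, Finset.sum_range]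

/-- The entries of the open-cluster Hamiltonian between decoded sector codes are the scaled integer block
entries divided by `S·Q`. [cite: LinGubernatis1993, §II] -/
theorem hubbardOpenBoxTT'_decode_decode (hQ : 0 < Q) (hS : 0 < C.S) {m m' : ℕ} (hm : m < 4 ^ (a * b))
    (hm' : m' < 4 ^ (a * b)) :
    hubbardOpenBoxTT' a b ((TN : ℝ) / Q) ((TD : ℝ) / Q) ((UU : ℝ) / Q) (decode m) (decode m') =
      ((C.hzCode a b TN TD UU m m' : ℝ) : ℂ) / (((C.S : ℝ) : ℂ) * ((Q : ℝ) : ℂ)) := by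
  rw [hubbardOpenBoxTT'_apply_eq_code, code_decode hm, code_decode hm', hzCode]
  have hS' : (C.S : ℂ) ≠ 0 := by exact_mod_cast hS.ne'
  have hQ' : (Q : ℂ) ≠ 0 := by exact_mod_cast hQ.ne'
  push_cast
  field_simp

/-- **SOUNDNESS of the kernel checker.** If `C.check a b p q TN TD UU Q = true`, then for every Fock
vector `v` supported in the spin sector `(N↑, N↓) = (p, q)` of the open `a × b` cluster,
`C.floor Q · ‖v‖² ≤ re ⟨v, H^open_{a×b}(TN/Q, TD/Q, UU/Q) v⟩`. [cite: KullEtAl2024, §5.3] [cite: Rump2006PosDef, §2] -/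
theorem sound (h : C.check a b p q TN TD UU Q = true) (v : Fock (Orb (Fin a ×ₗ Fin b)))
    (hv : ∀ s, ¬((upPart s).card = p ∧ (downPart s).card = q) → v s = 0) :
    ((C.floor Q : ℚ) : ℝ) * (star v ⬝ᵥ v).re ≤
      (star v ⬝ᵥ (hubbardOpenBoxTT' a b ((TN : ℝ) / Q) ((TD : ℝ) / Q) ((UU : ℝ) / Q) *ᵥ v)).re := by
  -- unpack the checker
  simp only [check, Bool.and_eq_true, decide_eq_true_eq] at h
  obtain ⟨⟨⟨⟨hQ, hS⟩, hK⟩, hrow⟩, hcol⟩ := h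
  -- `Fin n`-indexed data over the sector's code list
  let L := sectorList a b p q
  let n := (sectorList a b p q).length
  let w : Fin n → ℂ := fun i => v (decode (sectorList a b p q)[i])
  let hz : Fin n → Fin n → ℤ := fun i j => C.hzCode a b TN TD UU (sectorList a b p q)[i] (sectorList a b p q)[j]
  let lam : Fin n → Fin n → ℤ := fun i k => C.lamAt n i k
  let del : Fin n → ℕ := fun k => C.delAt k
  have hgetD : ∀ i : Fin n, (sectorList a b p q).getD i 0 = (sectorList a b p q)[i] :=
    fun i => List.getD_eq_getElem _ 0 i.isLt
  have hres : ∀ i j : Fin n, residual hz lam del C.K C.c i j =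
      C.resid a b TN TD UU (fun i => (sectorList a b p q).getD i 0) n i j := by
    intro i j
    simp only [residual, resid, hgetD, sumNat_eq_sum_fin, Fin.ext_iff, hz, lam, del]
  have hrow' : ∀ i : Fin n, ∑ j, |residual hz lam del C.K C.c i j| ≤ C.ρ := by
    intro i
    have h := of_allNat hrow i i.isLt
    rw [decide_eq_true_eq, sumNat_eq_sum_fin] at h
    simpa only [hres] using h
  have hcol' : ∀ j : Fin n, ∑ i, |residual hz lam del C.K C.c i j| ≤ C.ρ := by
    intro j
    have h := of_allNat hcol j j.isLt
    rw [decide_eq_true_eq, sumNat_eq_sum_fin] at h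
    simpa only [hres] using h
  have hineq := cert_ineq hz lam del C.K C.c C.ρ hrow' hcol' w
  -- the norm
  have hvv : star v ⬝ᵥ v = ∑ i : Fin n, (starRingEnd ℂ) (w i) * w i := by
    rw [dotProduct, ← Finset.sum_subset (Finset.subset_univ (sectorConfigs a b p q))
      (fun s _ hs => by rw [hv s (fun h => hs (mem_sectorConfigs.2 h)), mul_zero])]
    rw [sum_sector_eq_sum_fin]
    rfl
  have hvv_re : (star v ⬝ᵥ v).re = ∑ i : Fin n, ‖w i‖ ^ 2 := by
    rw [hvv, Complex.re_sum]
    refine Finset.sum_congr rfl fun i _ => ?_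
    rw [mul_comm, Complex.mul_conj, Complex.normSq_eq_norm_sq]
    norm_cast
  -- the quadratic form
  have hvHv : star v ⬝ᵥ (hubbardOpenBoxTT' a b ((TN : ℝ) / Q) ((TD : ℝ) / Q) ((UU : ℝ) / Q) *ᵥ v) =
      (∑ i : Fin n, ∑ j : Fin n, (starRingEnd ℂ) (w i) * (hz i j : ℂ) * w j) / (((C.S : ℝ) : ℂ) * ((Q : ℝ) : ℂ)) := by
    rw [dotProduct, ← Finset.sum_subset (Finset.subset_univ (sectorConfigs a b p q))
      (fun s _ hs => by rw [Pi.star_apply, hv s (fun h => hs (mem_sectorConfigs.2 h)), star_zero, zero_mul])]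
    rw [sum_sector_eq_sum_fin, Finset.sum_div]
    refine Finset.sum_congr rfl fun i _ => ?_
    rw [mulVec, dotProduct, ← Finset.sum_subset (Finset.subset_univ (sectorConfigs a b p q))
      (fun s _ hs => by rw [hv s (fun h => hs (mem_sectorConfigs.2 h)), mul_zero])]
    rw [sum_sector_eq_sum_fin, Pi.star_apply, Finset.mul_sum, Finset.sum_div]
    refine Finset.sum_congr rfl fun j _ => ?_
    have hi := (mem_sectorList.1 (List.getElem_mem (l := sectorList a b p q) i.isLt)).1
    have hj := (mem_sectorList.1 (List.getElem_mem (l := sectorList a b p q) j.isLt)).1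
    have hH := C.hubbardOpenBoxTT'_decode_decode (TN := TN) (TD := TD) (UU := UU) hQ hS hi hj
    simp only [w, hz, Fin.getElem_fin]
    rw [hH, Complex.ofReal_intCast, RCLike.star_def]
    ring
  have hSQ : (0 : ℝ) < (C.S : ℝ) * (Q : ℝ) := by positivity
  have hvHv_re : (star v ⬝ᵥ (hubbardOpenBoxTT' a b ((TN : ℝ) / Q) ((TD : ℝ) / Q) ((UU : ℝ) / Q) *ᵥ v)).re =
      (∑ i : Fin n, ∑ j : Fin n, (starRingEnd ℂ) (w i) * (hz i j : ℂ) * w j).re / ((C.S : ℝ) * (Q : ℝ)) := by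
    rw [hvHv, ← Complex.ofReal_mul, Complex.div_ofReal_re]
  rw [hvv_re, hvHv_re, floor]
  have hK' : (0 : ℝ) < (C.K : ℝ) := by exact_mod_cast hK
  rw [le_div_iff₀ hSQ]
  have hcast : (((((C.K : ℤ) * C.c - C.ρ : ℤ) : ℚ) / ((C.K : ℚ) * C.S * Q) : ℚ) : ℝ) =
      (((C.K : ℤ) * C.c - C.ρ : ℤ) : ℝ) / ((C.K : ℝ) * C.S * Q) := by push_cast; ring
  rw [hcast]
  have hnn : 0 ≤ ∑ i : Fin n, ‖w i‖ ^ 2 := Finset.sum_nonneg fun i _ => sq_nonneg _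
  -- from `(Kc − ρ) X ≤ K R` to `((Kc − ρ)/(K S Q)) X (S Q) ≤ R`
  have e : (((C.K : ℤ) * C.c - C.ρ : ℤ) : ℝ) / ((C.K : ℝ) * C.S * Q) * (∑ i : Fin n, ‖w i‖ ^ 2) * ((C.S : ℝ) * Q) =
      ((((C.K : ℤ) * C.c : ℤ) : ℝ) - C.ρ) * (∑ i : Fin n, ‖w i‖ ^ 2) / (C.K : ℝ) := by
    field_simp
    push_cast
    ring
  rw [e, div_le_iff₀ hK']
  push_cast at hineq ⊢
  linarith

end Sound

end SectorCert

/-! ### §3 From spin-sector floors to the `N`-sector ground-state energy -/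

section Assembly

variable {Λ : Type*} [LinearOrder Λ] [Fintype Λ]

/-- **Spin-sector floors give an `N`-sector floor** for a sector-preserving `H`: if for every `(p, q)`
with `p + q = N` and every `v` supported in the spin sector `(p, q)`, `σ ‖v‖² ≤ re⟨v, Hv⟩`, then
`σ ≤ E₀(H, N)` (`N ≤ |Orb Λ|`; an `N`-particle vector splits into its spin-sector components, the cross
terms vanish). [cite: LiebPRL1989, proof of Theorem 1] -/
theorem le_groundEnergy_of_spinSectorFloors (H : Matrix (Finset (Orb Λ)) (Finset (Orb Λ)) ℂ)
    (hH : PreservesSectors H) {N : ℕ} (hN : N ≤ Fintype.card (Orb Λ)) (σ : ℝ)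
    (h : ∀ p q : ℕ, p + q = N → ∀ v : Fock (Orb Λ), (∀ s, ¬((upPart s).card = p ∧ (downPart s).card = q) → v s = 0) →
      σ * (star v ⬝ᵥ v).re ≤ (star v ⬝ᵥ (H *ᵥ v)).re) :
    σ ≤ groundEnergy H N := by
  classical
  refine le_csInf (ThermodynamicLimit.groundEnergySet_nonempty H hN) ?_
  rintro E ⟨ψ, hψN, hψ1, rfl⟩
  -- spin components `ψ_p s = [#up s = p] ψ s`
  let comp : ℕ → Fock (Orb Λ) := fun p s => if (upPart s).card = p then ψ s else 0
  have hcomp_supp : ∀ p, ∀ s, ¬((upPart s).card = p ∧ (downPart s).card = N - p) → comp p s = 0 := by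
    intro p s hs
    by_cases hp : (upPart s).card = p
    · have hcard : s.card ≠ N := by
        intro hsN
        apply hs
        refine ⟨hp, ?_⟩
        have := card_eq_upPart_add_downPart s
        omega
      show (if (upPart s).card = p then ψ s else 0) = 0
      rw [if_pos hp, hψN s hcard]
    · show (if (upPart s).card = p then ψ s else 0) = 0
      rw [if_neg hp]
  have hdecomp : ψ = ∑ p ∈ range (N + 1), comp p := by
    funext s
    rw [Finset.sum_apply]
    by_cases hs : s.card = N
    · rw [Finset.sum_eq_single (upPart s).card]
      · show ψ s = if (upPart s).card = (upPart s).card then ψ s else 0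
        rw [if_pos rfl]
      · intro p _ hp
        show (if (upPart s).card = p then ψ s else 0) = 0
        rw [if_neg (Ne.symm hp)]
      · intro hmem
        exfalso
        apply hmem
        rw [mem_range]
        have := card_eq_upPart_add_downPart s
        omega
    · rw [hψN s hs]
      symm
      refine Finset.sum_eq_zero fun p _ => ?_
      show (if (upPart s).card = p then ψ s else 0) = 0
      split_ifs <;> [exact hψN s hs; rfl]
  -- cross terms vanish
  have hcross : ∀ p p', p ≠ p' → star (comp p) ⬝ᵥ (H *ᵥ comp p') = 0 := by
    intro p p' hpp
    rw [dotProduct]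
    refine Finset.sum_eq_zero fun s _ => ?_
    rw [mulVec, dotProduct, Finset.mul_sum]
    refine Finset.sum_eq_zero fun s' _ => ?_
    by_cases hps : (upPart s).card = p
    · by_cases hps' : (upPart s').card = p'
      · have hzero : H s s' = 0 := by
          by_contra hne
          exact hpp (hps ▸ hps' ▸ (hH s s' hne).1)
        rw [hzero]; simp
      · have : comp p' s' = 0 := by show (if (upPart s').card = p' then ψ s' else 0) = 0; rw [if_neg hps']
        rw [this]; simp
    · have : comp p s = 0 := by show (if (upPart s).card = p then ψ s else 0) = 0; rw [if_neg hps]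
      rw [Pi.star_apply, this]; simp
  have hcross' : ∀ p p', p ≠ p' → star (comp p) ⬝ᵥ comp p' = 0 := by
    intro p p' hpp
    rw [dotProduct]
    refine Finset.sum_eq_zero fun s _ => ?_
    by_cases hps : (upPart s).card = p
    · have : comp p' s = 0 := by
        show (if (upPart s).card = p' then ψ s else 0) = 0; rw [if_neg (fun h => hpp (hps.symm.trans h))]
      rw [this]; simp
    · have : comp p s = 0 := by show (if (upPart s).card = p then ψ s else 0) = 0; rw [if_neg hps]
      rw [Pi.star_apply, this]; simp
  -- expand `⟨ψ, Hψ⟩` and `⟨ψ, ψ⟩` over the components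
  have hHsum : star ψ ⬝ᵥ (H *ᵥ ψ) = ∑ p ∈ range (N + 1), star (comp p) ⬝ᵥ (H *ᵥ comp p) := by
    conv_lhs => rw [hdecomp]
    rw [star_sum, mulVec_sum, sum_dotProduct]
    refine Finset.sum_congr rfl fun p hp => ?_
    rw [dotProduct_sum, Finset.sum_eq_single p (fun p' _ hp' => hcross p p' (Ne.symm hp')) (fun h => absurd hp h)]
  have hNsum : star ψ ⬝ᵥ ψ = ∑ p ∈ range (N + 1), star (comp p) ⬝ᵥ comp p := by
    conv_lhs => rw [hdecomp]
    rw [star_sum, sum_dotProduct]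
    refine Finset.sum_congr rfl fun p hp => ?_
    rw [dotProduct_sum, Finset.sum_eq_single p (fun p' _ hp' => hcross' p p' (Ne.symm hp')) (fun h => absurd hp h)]
  have key : σ * (star ψ ⬝ᵥ ψ).re ≤ (star ψ ⬝ᵥ (H *ᵥ ψ)).re := by
    rw [hHsum, hNsum, Complex.re_sum, Complex.re_sum, Finset.mul_sum]
    refine Finset.sum_le_sum fun p hp => ?_
    have hpN : p + (N - p) = N := by rw [mem_range] at hp; omega
    exact h p (N - p) hpN (comp p) (hcomp_supp p)
  unfold Literature.MathematicalPhysics.QuantumLattice.expect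
  rw [hψ1, Complex.one_re, mul_one] at key
  exact key

/-- **Certificate form.** For the open `a × b` cluster with couplings `(TN/Q, TD/Q, UU/Q)` and a particle
number `k ≤ 2ab`: if for every `p ≤ k` a sector certificate `certs p` for the spin sector `(p, k − p)`
passes the kernel checker and its floor is `≥ σ`, then `σ ≤ E₀(h^open_{a×b}, k)` — the hypothesis of
the Anderson cluster bounds. [cite: KullEtAl2024, §5.3] [cite: Anderson1951, eq. (2)] -/
theorem groundEnergy_ge_of_sectorCerts (a b : ℕ) (TN TD UU : ℤ) (Q : ℕ) {k : ℕ} (hk : k ≤ 2 * (a * b))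
    (σ : ℚ) (certs : ℕ → SectorCert)
    (hcheck : ∀ p ≤ k, (certs p).check a b p (k - p) TN TD UU Q = true)
    (hσ : ∀ p ≤ k, σ ≤ (certs p).floor Q) :
    (σ : ℝ) ≤ groundEnergy (hubbardOpenBoxTT' a b ((TN : ℝ) / Q) ((TD : ℝ) / Q) ((UU : ℝ) / Q)) k := by
  have hc : Fintype.card (Orb (Fin a ×ₗ Fin b)) = a * b * 2 := by
    simp [Fintype.card_prod, Fintype.card_lex, Fintype.card_fin]
  have hcard : k ≤ Fintype.card (Orb (Fin a ×ₗ Fin b)) := by rw [hc]; omega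
  refine le_groundEnergy_of_spinSectorFloors _ (ThermodynamicLimit.preservesSectors_hubbardOpenBoxTT' a b _ _ _)
    hcard σ ?_
  intro p q hpq v hv
  have hp : p ≤ k := by omega
  have hq : q = k - p := by omega
  subst hq
  have hs := (certs p).sound (hcheck p hp) v hv
  have hfl : (σ : ℝ) ≤ (((certs p).floor Q : ℚ) : ℝ) := by exact_mod_cast hσ p hp
  have hnn : 0 ≤ (star v ⬝ᵥ v).re := by
    rw [dotProduct, Complex.re_sum]
    exact Finset.sum_nonneg fun s _ => by
      rw [Pi.star_apply, mul_comm, RCLike.star_def, Complex.mul_conj]; simp [Complex.normSq_nonneg]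
  exact le_trans (mul_le_mul_of_nonneg_right hfl hnn) hs

end Assembly

end OccupationCode

end Literature.MathematicalPhysics.QuantumLattice
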